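import Summits.BirchSwinnertonDyer.BirchSwinnertonDyer.Theorems.AdditiveBranchIMCTwistRootNumberDyadic
import Literature.NumberTheory.EllipticCurves.GlobalMinimalModel
import HarnessLib

/-!
# Route `AdditiveBranchIMC`, crux `GordTwoRankOne` (stmt-BirchSwinnertonDyer-19358), line `wan_tame_bdp_road`: the VOCABULARY of the
# dyadic Wan road («`2` as the Wan prime») under the Theorems import fence (definitions; nothing asserted)

Four predicates, BYTE-IDENTICAL in body to the line's scratch copies — `WanPrimeAny`, `EngineTwo`, `FieldOneTwo` of the registered skeleton
`Cruxes/GordTwoRankOne/Lines/wan_tame_bdp_road.lean` v23 (l.303, l.338, l.360; registry sha 1919872487cf) and `TameRoadFieldAny` of the pen's checked port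
`Cruxes/GordTwoRankOne/WanAnyRoadPort.lean` v1 (l.69; sha256 8cb68225fc3c8710) — so that (i) the Theorems-side port of the [L] stub `stub_dyadicWanChain`
(`AdditiveBranchIMCGordTwoRankOneWanAnyRoad{Field,Flat,Socket,StepL,ClosedHL}.lean`, namespace `…Theorems.WanAnyRoad`) can be stated over NAMED predicates,
and (ii) the two M stubs `stub_rootNumberDyadicWan : EngineTwo`, `stub_fieldOneDyadicWan : EngineTwo → FieldOneTwo` can be proved BY NAME AND SIGNATURE in a
Theorems file (`…WanAnyRoadStubs.lean`; the proofs are `TwistRootNumberDyadic.rootNumber_quadraticTwist_two_mul_eq_of_nonsplit_two` p777009 and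
`TwistRootNumberDyadic.fieldOneTwo_of_engineTwo` p776858). Cruxes files are not importable by Theorems (D-0016), hence this copy; the skeleton's
constants are definitionally equal to these (same bodies, same name resolution). The pattern of `AdditiveBranchIMCGordTwoRankOneTameRoadField.lean`
(`WanTameBdpRoadSupply`: «line vocabulary repeated verbatim … so that the stub can be stated by name and signature under the Theorems import fence»).

* `WanPrimeAny W p q` — a Wan prime WITHOUT the parity clause `q ≠ 2`: `q ≠ p`, non-split multiplicative reduction at `q`, `p ∤ v_q(Δ_min)`;
* `TameRoadFieldAny W p K` — the tame-road field over a Wan prime of any parity: `K` imaginary quadratic, `d_K < −4`, one Wan prime `q` with `q ∣ d_K`,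
  every other prime of `N_E` split, `2` split if `2 ∤ N_E`, `p` split;
* `EngineTwo` — the statement «`w(E^{(2ℓ)}) = w(E)`» for `E` non-split multiplicative at `2`, `ℓ ≡ 1 (mod 8)` good `≥ 5`, `(2ℓ/r) = 1` at the odd bad `r`
  (a THEOREM of the tree: p777009);
* `FieldOneTwo` — the statement of the rank-one field supply with `2` ramified (a THEOREM of the tree given Hoffstein–Luo as a named hypothesis inside the
  statement: p776858 ∘ p777009).

HONEST FRAMING: definitions only; no named fact is minted, nothing is asserted, nothing is booked; BSD is proved for no curve. A prover does not file
statement items (D-0014). Seat prover-bsd-addord-stub-1-g0 (director-bsd (587)(B): land the pen's port Theorems-side).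
References: [SkinnerUrban2014] Thm. 3.6.4 (the ramification clause `p ∤ v_q(Δ_min)`); [Rohrlich1993Compositio] Prop. 2–3; [HoffsteinLuo1997] Theorem (§1);
[FriedbergHoffstein1995] Thm. B.
-/

set_option autoImplicit false
set_option linter.dupNamespace false

noncomputable section

open scoped Classical

open NumberField IsDedekindDomain IsDedekindDomain.HeightOneSpectrum Rat.HeightOneSpectrum
open WeierstrassCurve Literature.NumberTheory.EllipticCurves
  Literature.NumberTheory.EllipticCurves.ModularForms

namespace Summit.BirchSwinnertonDyer.BirchSwinnertonDyer.Theorems.WanAnyRoad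

/-- A Wan prime WITHOUT THE PARITY CLAUSE: `q ≠ p`, NON-SPLIT multiplicative reduction at `q`, and Skinner–Urban's ramification clause
`p ∤ v_q(Δ_min)` — verbatim the skeleton's `WanTameBdpRoad.WanPrimeAny` (v23 l.303) and the port's `Port.WanPrimeAny`. [predicate; nothing asserted]
[cite: SkinnerUrban2014, Thm. 3.6.4] -/
def WanPrimeAny (W : WeierstrassCurve ℚ) [W.IsGloballyMinimal] (p q : ℕ) [Fact q.Prime] : Prop :=
  q ≠ p ∧ W.HasMultiplicativeReductionAtPrime q ∧ ¬ W.HasSplitMultiplicativeReductionAtPrime q ∧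
    ¬ p ∣ padicValInt q W.minimalDiscriminantInt

/-- Unfolding lemma for `WanPrimeAny`. [folklore] -/
theorem wanPrimeAny_iff (W : WeierstrassCurve ℚ) [W.IsGloballyMinimal] (p q : ℕ) [Fact q.Prime] :
    WanPrimeAny W p q ↔ q ≠ p ∧ W.HasMultiplicativeReductionAtPrime q ∧ ¬ W.HasSplitMultiplicativeReductionAtPrime q ∧
      ¬ p ∣ padicValInt q W.minimalDiscriminantInt := Iff.rfl

/-- THE TAME-ROAD FIELD OVER A WAN PRIME OF ANY PARITY: `K` imaginary quadratic with `d_K < -4` (so `𝓞_K^× = {±1}`), ONE Wan prime `q` (possibly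
`q = 2`) RAMIFIED in `K` (`q ∣ d_K`), every other prime of `N_E` split, `2` split if `2 ∤ N_E`, `p` split — verbatim the port's `Port.TameRoadFieldAny`
(`WanAnyRoadPort.lean` v1 l.69). For an odd Wan prime this is `ThreeFieldRoadSupply.TameRoadField` plus the consequence `d_K < -4`. [predicate; nothing asserted] -/
def TameRoadFieldAny (W : WeierstrassCurve ℚ) [W.IsGloballyMinimal] (p : ℕ)
    (K : Type) [Field K] [NumberField K] : Prop :=
  IsImaginaryQuadratic K ∧ NumberField.discr K < -4 ∧
    (∃ q : ℕ, ∃ _ : Fact q.Prime, WanPrimeAny W p q ∧ (q : ℤ) ∣ NumberField.discr K ∧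
      ∀ ℓ : ℕ, ℓ.Prime → ℓ ∣ W.conductorNorm ℤ → ℓ ≠ q →
        ((Ideal.span {(ℓ : ℤ)}).primesOver (𝓞 K)).ncard = 2) ∧
    (¬ 2 ∣ W.conductorNorm ℤ → ((Ideal.span {(2 : ℤ)}).primesOver (𝓞 K)).ncard = 2) ∧
    SatisfiesHeegnerHypothesis p K

/-- Unfolding lemma for `TameRoadFieldAny`. [folklore] -/
theorem tameRoadFieldAny_iff (W : WeierstrassCurve ℚ) [W.IsGloballyMinimal] (p : ℕ) (K : Type) [Field K] [NumberField K] :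
    TameRoadFieldAny W p K ↔
      IsImaginaryQuadratic K ∧ NumberField.discr K < -4 ∧
        (∃ q : ℕ, ∃ _ : Fact q.Prime, WanPrimeAny W p q ∧ (q : ℤ) ∣ NumberField.discr K ∧
          ∀ ℓ : ℕ, ℓ.Prime → ℓ ∣ W.conductorNorm ℤ → ℓ ≠ q →
            ((Ideal.span {(ℓ : ℤ)}).primesOver (𝓞 K)).ncard = 2) ∧
        (¬ 2 ∣ W.conductorNorm ℤ → ((Ideal.span {(2 : ℤ)}).primesOver (𝓞 K)).ncard = 2) ∧
        SatisfiesHeegnerHypothesis p K := Iff.rfl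

/-- **E2 (i) — THE STATEMENT OF THE ROOT-NUMBER ENGINE AT THE 2-RAMIFIED TWIST OF A NON-SPLIT MULTIPLICATIVE `2`** (verbatim the skeleton's
`WanTameBdpRoad.EngineTwo`, v23 l.338): for `E / ℚ` (globally minimal `W`, modular, every ODD additive prime of quadratic-twist type) with NON-SPLIT
multiplicative reduction at `2`, and a good prime `ℓ ≥ 5` with `ℓ ≡ 1 (mod 8)` and `(2ℓ/r) = 1` at every odd prime `r` of `N_E`: `w(E^{(2ℓ)}) = w(E)`.
A THEOREM of the tree (`TwistRootNumberDyadic.rootNumber_quadraticTwist_two_mul_eq_of_nonsplit_two`, p777009); stated here as a `Prop` only because the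
registered stub signature is `stub_rootNumberDyadicWan : EngineTwo` (Rohrlich 1993, Prop. 2 (ii)–(iv), Prop. 3, is the local content; this is LINE VOCABULARY, not a
Literature fact — the witness `engineTwo_holds` is below). [statement; nothing asserted; proved below] -/
def EngineTwo : Prop :=
  ∀ (W : WeierstrassCurve ℚ) [W.IsElliptic] [W.IsGloballyMinimal], exists_isNewformOf →
    (∀ r : Nat.Primes, (r : ℕ) ≠ 2 → W.HasAdditiveReductionAt ((primesEquiv (R := ℤ)).symm r) →
      ¬ (W.quadraticTwist (((-1 : ℤ) ^ ((r : ℕ) / 2) * r : ℤ) : ℚ)).HasAdditiveReductionAt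
        ((primesEquiv (R := ℤ)).symm r)) →
    W.HasMultiplicativeReductionAtPrime 2 → ¬ W.HasSplitMultiplicativeReductionAtPrime 2 →
    ∀ (ℓ : ℕ) [Fact ℓ.Prime], 5 ≤ ℓ → W.HasGoodReductionAtPrime ℓ → (ℓ : ℤ) % 8 = 1 →
      (∀ r : ℕ, r.Prime → r ∣ W.conductorNorm ℤ → r ≠ 2 → jacobiSym ((2 : ℤ) * ℓ) r = 1) →
      (W.quadraticTwist (((2 : ℤ) * ℓ : ℤ) : ℚ)).rootNumber = W.rootNumber

/-- **E2 (ii) — THE STATEMENT OF THE RANK-ONE FIELD SUPPLY WITH `2` RAMIFIED** (verbatim the skeleton's `WanTameBdpRoad.FieldOneTwo`, v23 l.360, and the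
port's `Port.FieldOneTwo`): for `E / ℚ` as in `EngineTwo` with `w(E) = −1`, Hoffstein–Luo 1997 as a named hypothesis, an odd prime `p` and a bound `B`: an
imaginary quadratic `K` with `|d_K| > B`, `2 ∣ d_K`, every ODD prime of `N_E` split in `K`, `p` split, and `L(E^{(d_K)}, 1) ≠ 0`. A THEOREM of the tree
(`TwistRootNumberDyadic.fieldOneTwo`, p777009 ∘ p776858; Hoffstein–Luo 1997 Theorem §1 and Friedberg–Hoffstein 1995 Thm. B are the print behind it; this is
LINE VOCABULARY, not a Literature fact — the witness `fieldOneTwo_holds` is below). [statement; nothing asserted; proved below] -/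
def FieldOneTwo : Prop :=
  ∀ (W : WeierstrassCurve ℚ) [W.IsElliptic] [W.IsGloballyMinimal], exists_isNewformOf →
    Literature.NumberTheory.EllipticCurves.HoffsteinLuo1997_exists_twist_L_one_ne_zero →
    (∀ r : Nat.Primes, (r : ℕ) ≠ 2 → W.HasAdditiveReductionAt ((primesEquiv (R := ℤ)).symm r) →
      ¬ (W.quadraticTwist (((-1 : ℤ) ^ ((r : ℕ) / 2) * r : ℤ) : ℚ)).HasAdditiveReductionAt
        ((primesEquiv (R := ℤ)).symm r)) →
    W.rootNumber = -1 → W.HasMultiplicativeReductionAtPrime 2 → ¬ W.HasSplitMultiplicativeReductionAtPrime 2 →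
    ∀ (p : ℕ), p.Prime → p ≠ 2 → ∀ B : ℕ,
      ∃ (K : Type) (_ : Field K) (_ : NumberField K),
        IsImaginaryQuadratic K ∧ B < (NumberField.discr K).natAbs ∧ (2 : ℤ) ∣ NumberField.discr K ∧
          (∀ ℓ : ℕ, ℓ.Prime → ℓ ∣ W.conductorNorm ℤ → ℓ ≠ 2 →
            ((Ideal.span {(ℓ : ℤ)}).primesOver (𝓞 K)).ncard = 2) ∧
          SatisfiesHeegnerHypothesis p K ∧
          (W.quadraticTwist (NumberField.discr K : ℚ)).entireLFunction 1 ≠ 0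

/-- `EngineTwo` HOLDS: the tree's engine `TwistRootNumberDyadic.rootNumber_quadraticTwist_two_mul_eq_of_nonsplit_two` (p777009) has literally this type.
[cite: Rohrlich1993Compositio, Prop. 2 (ii)–(iv) and Prop. 3] [cite: AtkinLi1978, §3] -/
theorem engineTwo_holds : EngineTwo :=
  TwistRootNumberDyadic.rootNumber_quadraticTwist_two_mul_eq_of_nonsplit_two

/-- `EngineTwo → FieldOneTwo` HOLDS: the tree's `TwistRootNumberDyadic.fieldOneTwo_of_engineTwo` (p776858) has literally this type.
[cite: HoffsteinLuo1997, Theorem (§1, pp. 435–436)] [cite: FriedbergHoffstein1995, Thm. B] -/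
theorem fieldOneTwo_of_engineTwo_holds : EngineTwo → FieldOneTwo :=
  TwistRootNumberDyadic.fieldOneTwo_of_engineTwo

/-- `FieldOneTwo` HOLDS unconditionally (`TwistRootNumberDyadic.fieldOneTwo`, p777009 ∘ p776858). [cite: HoffsteinLuo1997, Theorem (§1, pp. 435–436)] -/
theorem fieldOneTwo_holds : FieldOneTwo :=
  TwistRootNumberDyadic.fieldOneTwo

end Summit.BirchSwinnertonDyer.BirchSwinnertonDyer.Theorems.WanAnyRoad

end
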